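import Mathlib

/-!
# Crux `DisclinationRation.FiveFoldRation` (stmt-AtomisticToContinuum-15799), line `Sketch` —
# helpers for stub `stub_dr5_capping` (octahedron completion), part 2: the core argument

The octahedron completion with everything abstracted: a set `S` in a real inner product space,
a "nearest-neighbour distance" `nd : E → ℝ` and a "first shell" `Sh : E → Set E` tied together
only by the membership rule `z ∈ Sh y ↔ z ∈ S ∧ z ≠ y ∧ dist z y < 13/10 · nd y`, the
shell-symmetry conclusions (`hSM`, statement of stub `stub_dr5_shellMutual`), the link lemma
(`hLK`, statement of stub `stub_dr5_links`) and, at every site, a `1/20`-matching of its shell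
with SOME pattern `P` of unit vectors, pairwise `≥ 1` apart, with spectrum gap `(26/25, 7/5)` and
the two clauses of the dichotomy (statement of stub `stub_dr5_dichotomy`).

* `dr5ca_para` (parallelogram at `y`): for a square face `t₁ t₂ t₃ t₄` of the link of `y` the
  images form an induced `4`-cycle, hence a parallelogram `T₁ + T₃ = T₂ + T₄`; metrically
  `‖(t₂ + t₄ - y) - t₁‖ ≥ 17/20 · d_y`, `‖(t₁ + t₃ - y) - t₂‖ ≥ 17/20 · d_y` and the two candidate
  apices `t₂ + t₄ - y`, `t₁ + t₃ - y` are within `d_y / 5`.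
* `dr5ca_corner` (square corner read in the shell of `u`): for shell-mates `a, b, c` of `u` with
  `b, c` shell-adjacent to `a` but not to each other, and `‖b + c - a - u‖ > 76/100 · d_u`, the
  dichotomy cannot fold back (that would give `‖b + c - a - u‖ ≤ (61/100 + 3/20) · d_u`), so the
  apex `T_b + T_c - Y_a` is a pattern point, i.e. a site `x ∈ Sh u` within `d_u / 5` of
  `b + c - a`; the link lemma at `u` gives `x ∈ Sh b`, `x ∈ Sh c`, and the parallelogram law
  (`‖X - Y_a‖² ≥ 4 - 9/4 > (26/25)²`) gives `x ∉ Sh a`, `x ≠ a`.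
* `dr5ca_core`: corner `(y; t₂, t₄)` in the shell of `t₁` gives the cap `x`; corner `(y; t₁, t₃)`
  in the shell of `t₂` gives a site `z ∈ Sh t₃` with
  `dist z x ≤ 0.62 · d_y < 6/7 · d_y ≤ 9/10 · d_{t₂}`, so `z = x` by the separation of shell points
  (`dr5ca_shell_sep`).
Helper prefix `dr5ca_`.
-/

noncomputable section

namespace Summit.AtomisticToContinuum.Crystallization.Theorems

/-! ### Tolerance algebra in vector form -/

/-- A `1/20`-matching after rescaling by `d⁻¹` is a `d/20`-matching before rescaling. -/
theorem dr5ca_tol_vec {E : Type*} [NormedAddCommGroup E] [NormedSpace ℝ E] {d : ℝ} (hd : 0 < d)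
    {v a : E} (h : dist (d⁻¹ • v) a ≤ 1 / 20) : dist v (d • a) ≤ d / 20 := by
  have h0 : v = d • (d⁻¹ • v) := by rw [smul_smul, mul_inv_cancel₀ hd.ne', one_smul]
  have h1 : dist v (d • a) = d * dist (d⁻¹ • v) a := by
    calc dist v (d • a) = dist (d • (d⁻¹ • v)) (d • a) := by rw [← h0]
      _ = d * dist (d⁻¹ • v) a := by rw [dist_smul₀, Real.norm_of_nonneg hd.le]
  rw [h1]
  have := mul_le_mul_of_nonneg_left h hd.le
  linarith

/-- Three matched vectors: `dist (v₂ + v₃ - v₁) (w₂ + w₃ - w₁) ≤ 3 r`. -/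
theorem dr5ca_three {E : Type*} [NormedAddCommGroup E] {r : ℝ} {v₁ v₂ v₃ w₁ w₂ w₃ : E}
    (h₁ : dist v₁ w₁ ≤ r) (h₂ : dist v₂ w₂ ≤ r) (h₃ : dist v₃ w₃ ≤ r) :
    dist (v₂ + v₃ - v₁) (w₂ + w₃ - w₁) ≤ 3 * r :=
  calc dist (v₂ + v₃ - v₁) (w₂ + w₃ - w₁) ≤ dist (v₂ + v₃) (w₂ + w₃) + dist v₁ w₁ :=
        dist_sub_sub_le _ _ _ _
    _ ≤ dist v₂ w₂ + dist v₃ w₃ + dist v₁ w₁ := by gcongr; exact dist_add_add_le _ _ _ _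
    _ ≤ 3 * r := by linarith

/-- Four matched vectors: `dist (v₂ + v₄ - v₁ - v₃) (w₂ + w₄ - w₁ - w₃) ≤ 4 r`. -/
theorem dr5ca_four {E : Type*} [NormedAddCommGroup E] {r : ℝ} {v₁ v₂ v₃ v₄ w₁ w₂ w₃ w₄ : E}
    (h₁ : dist v₁ w₁ ≤ r) (h₂ : dist v₂ w₂ ≤ r) (h₃ : dist v₃ w₃ ≤ r) (h₄ : dist v₄ w₄ ≤ r) :
    dist (v₂ + v₄ - v₁ - v₃) (w₂ + w₄ - w₁ - w₃) ≤ 4 * r :=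
  calc dist (v₂ + v₄ - v₁ - v₃) (w₂ + w₄ - w₁ - w₃)
        ≤ dist (v₂ + v₄ - v₁) (w₂ + w₄ - w₁) + dist v₃ w₃ := dist_sub_sub_le _ _ _ _
    _ ≤ dist (v₂ + v₄) (w₂ + w₄) + dist v₁ w₁ + dist v₃ w₃ := by
        gcongr; exact dist_sub_sub_le _ _ _ _
    _ ≤ dist v₂ w₂ + dist v₄ w₄ + dist v₁ w₁ + dist v₃ w₃ := by
        gcongr; exact dist_add_add_le _ _ _ _
    _ ≤ 4 * r := by linarith

/-- A vector within `r` of `d • a`, `‖a‖ = 1`, has norm `≥ d - r`. -/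
theorem dr5ca_norm_ge {E : Type*} [NormedAddCommGroup E] [NormedSpace ℝ E] {d r : ℝ} (hd : 0 ≤ d)
    {w a : E} (ha : ‖a‖ = 1) (h : dist w (d • a) ≤ r) : d - r ≤ ‖w‖ := by
  have h1 : ‖d • a‖ = d := by rw [norm_smul, Real.norm_of_nonneg hd, ha, mul_one]
  have h2 := dist_triangle (d • a) w 0
  rw [dist_zero_right, dist_zero_right, h1, dist_comm] at h2
  linarith

/-- **Separation of shell points.** Two distinct points of a set `T` that is `1/20`-matched
(centre `u`, scale `d`) to a pattern with pairwise distances `≥ 1` are `≥ 9/10 · d` apart. -/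
theorem dr5ca_shell_sep {E : Type*} [NormedAddCommGroup E] [NormedSpace ℝ E] {T P : Set E}
    (hP2 : ∀ p ∈ P, ∀ q ∈ P, p ≠ q → 1 ≤ dist p q) {u : E} {d : ℝ} (hd : 0 < d)
    (A : E →ₗᵢ[ℝ] E) (e : ↥T ≃ ↥P)
    (htol : ∀ t : ↥T, dist (d⁻¹ • (t.1 - u)) (A (e t).1) ≤ 1 / 20) {x z : E} (hx : x ∈ T)
    (hz : z ∈ T) (hne : x ≠ z) : 9 / 10 * d ≤ dist x z := by
  have hX : dist (d • A (e ⟨x, hx⟩).1) (x - u) ≤ d / 20 := by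
    rw [dist_comm]; exact dr5ca_tol_vec hd (htol ⟨x, hx⟩)
  have hZ : dist (z - u) (d • A (e ⟨z, hz⟩).1) ≤ d / 20 := dr5ca_tol_vec hd (htol ⟨z, hz⟩)
  have hne' : (e ⟨x, hx⟩).1 ≠ (e ⟨z, hz⟩).1 := fun h =>
    hne (congrArg Subtype.val (e.injective (Subtype.ext h)))
  have h1 := mul_le_mul_of_nonneg_left (hP2 _ (e ⟨x, hx⟩).2 _ (e ⟨z, hz⟩).2 hne') hd.le
  have h2 : dist (d • A (e ⟨x, hx⟩).1) (d • A (e ⟨z, hz⟩).1) =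
      d * dist (e ⟨x, hx⟩).1 (e ⟨z, hz⟩).1 := by
    rw [dist_smul₀, Real.norm_of_nonneg hd.le, A.dist_map]
  have h3 := dist_triangle4 (d • A (e ⟨x, hx⟩).1) (x - u) (z - u) (d • A (e ⟨z, hz⟩).1)
  rw [h2, dist_sub_right] at h3
  linarith

/-! ### The parallelogram at `y` -/

/-- **Parallelogram at `y`.** For a square face `t₁ t₂ t₃ t₄` of the link of `y` (consecutive
vertices shell-adjacent, diagonals not), in a `1/20`-matching of the shell of `y` with a pattern
of unit vectors satisfying the links rule `hlk` and the parallelogram clause `hDii` of the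
dichotomy: `17/20 · d_y ≤ ‖t₂ + t₄ - y - t₁‖`, `17/20 · d_y ≤ ‖t₁ + t₃ - y - t₂‖`, and
`dist (t₂ + t₄ - y) (t₁ + t₃ - y) ≤ d_y / 5`. -/
theorem dr5ca_para {E : Type*} [NormedAddCommGroup E] [InnerProductSpace ℝ E] {S : Set E}
    {nd : E → ℝ} {Sh : E → Set E}
    (hSh : ∀ y z, z ∈ Sh y ↔ z ∈ S ∧ z ≠ y ∧ dist z y < 13 / 10 * nd y)
    {P : Set E} (hP1 : ∀ p ∈ P, ‖p‖ = 1)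
    (hDii : ∀ T₁ ∈ P, ∀ T₂ ∈ P, ∀ T₃ ∈ P, ∀ T₄ ∈ P, dist T₁ T₂ ≤ 26 / 25 →
      dist T₂ T₃ ≤ 26 / 25 → dist T₃ T₄ ≤ 26 / 25 → dist T₄ T₁ ≤ 26 / 25 →
      26 / 25 < dist T₁ T₃ → 26 / 25 < dist T₂ T₄ → T₁ + T₃ = T₂ + T₄)
    {y : E} (hd : 0 < nd y) (A : E →ₗᵢ[ℝ] E) (e : ↥(Sh y) ≃ ↥P)
    (htol : ∀ t : ↥(Sh y), dist ((nd y)⁻¹ • (t.1 - y)) (A (e t).1) ≤ 1 / 20)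
    (hlk : ∀ t t' : ↥(Sh y), t ≠ t' → (t'.1 ∈ Sh t.1 ↔ dist (e t).1 (e t').1 ≤ 26 / 25))
    {t₁ t₂ t₃ t₄ : E} (h1 : t₁ ∈ Sh y) (h2 : t₂ ∈ Sh y) (h3 : t₃ ∈ Sh y) (h4 : t₄ ∈ Sh y)
    (h12 : t₂ ∈ Sh t₁) (h23 : t₃ ∈ Sh t₂) (h34 : t₄ ∈ Sh t₃) (h41 : t₁ ∈ Sh t₄)
    (h13 : t₃ ∉ Sh t₁) (h24 : t₄ ∉ Sh t₂) (hne13 : t₁ ≠ t₃) (hne24 : t₂ ≠ t₄) :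
    17 / 20 * nd y ≤ ‖t₂ + t₄ - y - t₁‖ ∧ 17 / 20 * nd y ≤ ‖t₁ + t₃ - y - t₂‖ ∧
      dist (t₂ + t₄ - y) (t₁ + t₃ - y) ≤ nd y / 5 := by
  -- the images of the four shell points
  set T₁ : E := (e ⟨t₁, h1⟩).1 with hT₁
  set T₂ : E := (e ⟨t₂, h2⟩).1 with hT₂
  set T₃ : E := (e ⟨t₃, h3⟩).1 with hT₃
  set T₄ : E := (e ⟨t₄, h4⟩).1 with hT₄
  -- distinctness of the shell points
  have n12 : (⟨t₁, h1⟩ : ↥(Sh y)) ≠ ⟨t₂, h2⟩ := fun h =>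
    ((hSh t₁ t₂).1 h12).2.1 (congrArg Subtype.val h).symm
  have n23 : (⟨t₂, h2⟩ : ↥(Sh y)) ≠ ⟨t₃, h3⟩ := fun h =>
    ((hSh t₂ t₃).1 h23).2.1 (congrArg Subtype.val h).symm
  have n34 : (⟨t₃, h3⟩ : ↥(Sh y)) ≠ ⟨t₄, h4⟩ := fun h =>
    ((hSh t₃ t₄).1 h34).2.1 (congrArg Subtype.val h).symm
  have n41 : (⟨t₄, h4⟩ : ↥(Sh y)) ≠ ⟨t₁, h1⟩ := fun h =>
    ((hSh t₄ t₁).1 h41).2.1 (congrArg Subtype.val h).symm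
  have n13 : (⟨t₁, h1⟩ : ↥(Sh y)) ≠ ⟨t₃, h3⟩ := fun h => hne13 (congrArg Subtype.val h)
  have n24 : (⟨t₂, h2⟩ : ↥(Sh y)) ≠ ⟨t₄, h4⟩ := fun h => hne24 (congrArg Subtype.val h)
  -- the images form an induced 4-cycle, hence a parallelogram
  have a12 : dist T₁ T₂ ≤ 26 / 25 := (hlk _ _ n12).1 h12
  have a23 : dist T₂ T₃ ≤ 26 / 25 := (hlk _ _ n23).1 h23
  have a34 : dist T₃ T₄ ≤ 26 / 25 := (hlk _ _ n34).1 h34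
  have a41 : dist T₄ T₁ ≤ 26 / 25 := (hlk _ _ n41).1 h41
  have a13 : 26 / 25 < dist T₁ T₃ := not_le.1 fun h => h13 ((hlk _ _ n13).2 h)
  have a24 : 26 / 25 < dist T₂ T₄ := not_le.1 fun h => h24 ((hlk _ _ n24).2 h)
  have hpar : T₁ + T₃ = T₂ + T₄ :=
    hDii T₁ (e ⟨t₁, h1⟩).2 T₂ (e ⟨t₂, h2⟩).2 T₃ (e ⟨t₃, h3⟩).2 T₄ (e ⟨t₄, h4⟩).2 a12 a23 a34
      a41 a13 a24
  -- tolerance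
  have v1 : dist (t₁ - y) (nd y • A T₁) ≤ nd y / 20 := dr5ca_tol_vec hd (htol ⟨t₁, h1⟩)
  have v2 : dist (t₂ - y) (nd y • A T₂) ≤ nd y / 20 := dr5ca_tol_vec hd (htol ⟨t₂, h2⟩)
  have v3 : dist (t₃ - y) (nd y • A T₃) ≤ nd y / 20 := dr5ca_tol_vec hd (htol ⟨t₃, h3⟩)
  have v4 : dist (t₄ - y) (nd y • A T₄) ≤ nd y / 20 := dr5ca_tol_vec hd (htol ⟨t₄, h4⟩)
  refine ⟨?_, ?_, ?_⟩
  · have h := dr5ca_three v1 v2 v4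
    have e1 : t₂ - y + (t₄ - y) - (t₁ - y) = t₂ + t₄ - y - t₁ := by abel
    have e2 : nd y • A T₂ + nd y • A T₄ - nd y • A T₁ = nd y • A T₃ := by
      rw [eq_sub_of_add_eq' hpar, map_sub, map_add, smul_sub, smul_add]
    rw [e1, e2] at h
    have hn : ‖A T₃‖ = 1 := by rw [A.norm_map]; exact hP1 _ (e ⟨t₃, h3⟩).2
    have := dr5ca_norm_ge hd.le hn h
    linarith
  · have h := dr5ca_three v2 v1 v3
    have e1 : t₁ - y + (t₃ - y) - (t₂ - y) = t₁ + t₃ - y - t₂ := by abel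
    have e2 : nd y • A T₁ + nd y • A T₃ - nd y • A T₂ = nd y • A T₄ := by
      rw [eq_sub_of_add_eq' hpar.symm, map_sub, map_add, smul_sub, smul_add]
    rw [e1, e2] at h
    have hn : ‖A T₄‖ = 1 := by rw [A.norm_map]; exact hP1 _ (e ⟨t₄, h4⟩).2
    have := dr5ca_norm_ge hd.le hn h
    linarith
  · have h := dr5ca_four v1 v2 v3 v4
    have e1 : t₂ - y + (t₄ - y) - (t₁ - y) - (t₃ - y) = (t₂ + t₄ - y) - (t₁ + t₃ - y) := by abel
    have e2 : nd y • A T₂ + nd y • A T₄ - nd y • A T₁ - nd y • A T₃ =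
        nd y • A (T₂ + T₄ - T₁ - T₃) := by
      simp only [map_sub, map_add, smul_sub, smul_add]
    have e3 : T₂ + T₄ - T₁ - T₃ = 0 := by rw [← hpar]; abel
    rw [e1, e2, e3, map_zero, smul_zero, dist_zero_right, ← dist_eq_norm] at h
    linarith

/-! ### The square corner read in the shell of a neighbour -/

/-- **Square corner at a shell-mate.** In a `1/20`-matching `(A, e)` of the shell of `u` with a
pattern `P` (pairwise `≥ 1`, links rule `hlk`, dichotomy clause `hDi`): if `a, b, c ∈ Sh u`,
`b, c ∈ Sh a`, `c ∉ Sh b`, `b ≠ c`, and `‖b + c - a - u‖ > 76/100 · d_u`, then there is a shell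
point `x ∈ Sh u` with `dist x (b + c - a) ≤ d_u / 5`, `x ∈ Sh b`, `x ∈ Sh c`, `x ∉ Sh a`,
`x ≠ a`. -/
theorem dr5ca_corner {E : Type*} [NormedAddCommGroup E] [InnerProductSpace ℝ E] {S : Set E}
    {nd : E → ℝ} {Sh : E → Set E}
    (hSh : ∀ y z, z ∈ Sh y ↔ z ∈ S ∧ z ≠ y ∧ dist z y < 13 / 10 * nd y)
    {P : Set E} (hP2 : ∀ p ∈ P, ∀ q ∈ P, p ≠ q → 1 ≤ dist p q)
    (hDi : ∀ Y ∈ P, ∀ T ∈ P, ∀ T' ∈ P, dist Y T ≤ 26 / 25 → dist Y T' ≤ 26 / 25 → T ≠ T' →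
      26 / 25 < dist T T' → (T + T' - Y ∈ P ∧ dist T T' ≤ 3 / 2) ∨ ‖T + T' - Y‖ ≤ 61 / 100)
    {u : E} (hd : 0 < nd u) (A : E →ₗᵢ[ℝ] E) (e : ↥(Sh u) ≃ ↥P)
    (htol : ∀ t : ↥(Sh u), dist ((nd u)⁻¹ • (t.1 - u)) (A (e t).1) ≤ 1 / 20)
    (hlk : ∀ t t' : ↥(Sh u), t ≠ t' → (t'.1 ∈ Sh t.1 ↔ dist (e t).1 (e t').1 ≤ 26 / 25))
    {a b c : E} (ha : a ∈ Sh u) (hb : b ∈ Sh u) (hc : c ∈ Sh u) (hba : b ∈ Sh a)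
    (hca : c ∈ Sh a) (hcb : c ∉ Sh b) (hbc : b ≠ c) (hfar : 76 / 100 * nd u < ‖b + c - a - u‖) :
    ∃ x ∈ Sh u, dist x (b + c - a) ≤ nd u / 5 ∧ x ∈ Sh b ∧ x ∈ Sh c ∧ x ∉ Sh a ∧ x ≠ a := by
  -- the images
  set Ya : E := (e ⟨a, ha⟩).1 with hYa
  set Tb : E := (e ⟨b, hb⟩).1 with hTb
  set Tc : E := (e ⟨c, hc⟩).1 with hTc
  have hab : (⟨a, ha⟩ : ↥(Sh u)) ≠ ⟨b, hb⟩ := fun h =>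
    ((hSh a b).1 hba).2.1 (congrArg Subtype.val h).symm
  have hac : (⟨a, ha⟩ : ↥(Sh u)) ≠ ⟨c, hc⟩ := fun h =>
    ((hSh a c).1 hca).2.1 (congrArg Subtype.val h).symm
  have hbc' : (⟨b, hb⟩ : ↥(Sh u)) ≠ ⟨c, hc⟩ := fun h => hbc (congrArg Subtype.val h)
  have hYb : dist Ya Tb ≤ 26 / 25 := (hlk _ _ hab).1 hba
  have hYc : dist Ya Tc ≤ 26 / 25 := (hlk _ _ hac).1 hca
  have hTbc : 26 / 25 < dist Tb Tc := not_le.1 fun h => hcb ((hlk _ _ hbc').2 h)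
  have hne : Tb ≠ Tc := fun h => hbc' (e.injective (Subtype.ext h))
  have hbY : Tb ≠ Ya := fun h => hab (e.injective (Subtype.ext h)).symm
  have hcY : Tc ≠ Ya := fun h => hac (e.injective (Subtype.ext h)).symm
  -- tolerance
  have hva : dist (a - u) (nd u • A Ya) ≤ nd u / 20 := dr5ca_tol_vec hd (htol ⟨a, ha⟩)
  have hvb : dist (b - u) (nd u • A Tb) ≤ nd u / 20 := dr5ca_tol_vec hd (htol ⟨b, hb⟩)
  have hvc : dist (c - u) (nd u • A Tc) ≤ nd u / 20 := dr5ca_tol_vec hd (htol ⟨c, hc⟩)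
  have h3 : dist (b + c - a - u) (nd u • A (Tb + Tc - Ya)) ≤ 3 * (nd u / 20) := by
    have e1 : b + c - a - u = b - u + (c - u) - (a - u) := by abel
    rw [e1, map_sub, map_add, smul_sub, smul_add]
    exact dr5ca_three hva hvb hvc
  rcases hDi Ya (e ⟨a, ha⟩).2 Tb (e ⟨b, hb⟩).2 Tc (e ⟨c, hc⟩).2 hYb hYc hne hTbc with
    ⟨hX, h32⟩ | hfold
  · -- square case: the apex is a pattern point, hence a shell point `x` of `u`
    obtain ⟨tx, htx⟩ : ∃ tx : ↥(Sh u), (e tx).1 = Tb + Tc - Ya :=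
      ⟨e.symm ⟨Tb + Tc - Ya, hX⟩, by rw [Equiv.apply_symm_apply]⟩
    have hvx : dist (tx.1 - u) (nd u • A (Tb + Tc - Ya)) ≤ nd u / 20 := by
      have := dr5ca_tol_vec hd (htol tx)
      rwa [htx] at this
    -- the parallelogram law: `‖X - Ya‖² ≥ 4 - 9/4`
    have hp : 1 ≤ ‖Tb - Ya‖ := by rw [← dist_eq_norm]; exact hP2 _ (e ⟨b, hb⟩).2 _ (e ⟨a, ha⟩).2 hbY
    have hq : 1 ≤ ‖Tc - Ya‖ := by rw [← dist_eq_norm]; exact hP2 _ (e ⟨c, hc⟩).2 _ (e ⟨a, ha⟩).2 hcY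
    have hpq : ‖Tb - Tc‖ ≤ 3 / 2 := by rw [← dist_eq_norm]; exact h32
    have hlaw := parallelogram_law_with_norm ℝ (Tb - Ya) (Tc - Ya)
    have e3 : Tb - Ya + (Tc - Ya) = Tb + Tc - Ya - Ya := by abel
    have e4 : Tb - Ya - (Tc - Ya) = Tb - Tc := by abel
    rw [e3, e4] at hlaw
    have hp2 : 1 ≤ ‖Tb - Ya‖ ^ 2 := by nlinarith
    have hq2 : 1 ≤ ‖Tc - Ya‖ ^ 2 := by nlinarith
    have hpq2 : ‖Tb - Tc‖ ^ 2 ≤ 9 / 4 := by nlinarith [norm_nonneg (Tb - Tc)]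
    have hbig : 26 / 25 < ‖Tb + Tc - Ya - Ya‖ := by
      have hsq : (26 / 25 : ℝ) ^ 2 < ‖Tb + Tc - Ya - Ya‖ ^ 2 := by nlinarith
      exact lt_of_pow_lt_pow_left₀ 2 (norm_nonneg _) hsq
    have hax : (⟨a, ha⟩ : ↥(Sh u)) ≠ tx := by
      intro h
      have h0 : Tb + Tc - Ya - Ya = 0 := by rw [← htx, ← h, ← hYa, sub_self]
      rw [h0, norm_zero] at hbig
      norm_num at hbig
    have hbig' : 26 / 25 < dist Ya (e tx).1 := by rwa [htx, dist_comm, dist_eq_norm]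
    have hbx : (⟨b, hb⟩ : ↥(Sh u)) ≠ tx := by
      intro h
      have h0 : Tb = Tb + Tc - Ya := by rw [← htx, ← h]
      have h1 : Tc - Ya = 0 := by
        calc Tc - Ya = Tb + Tc - Ya - Tb := by abel
          _ = 0 := by rw [← h0, sub_self]
      exact hcY (sub_eq_zero.1 h1)
    have hcx : (⟨c, hc⟩ : ↥(Sh u)) ≠ tx := by
      intro h
      have h0 : Tc = Tb + Tc - Ya := by rw [← htx, ← h]
      have h1 : Tb - Ya = 0 := by
        calc Tb - Ya = Tb + Tc - Ya - Tc := by abel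
          _ = 0 := by rw [← h0, sub_self]
      exact hbY (sub_eq_zero.1 h1)
    refine ⟨tx.1, tx.2, ?_, ?_, ?_, ?_, fun h => hax (Subtype.ext h).symm⟩
    · -- `dist x (b + c - a) ≤ d_u / 5`
      rw [← dist_sub_right tx.1 (b + c - a) u]
      have := dist_triangle (tx.1 - u) (nd u • A (Tb + Tc - Ya)) (b + c - a - u)
      rw [dist_comm] at h3
      linarith
    · -- `x ∈ Sh b`
      refine (hlk _ _ hbx).2 ?_
      have : dist Tb (Tb + Tc - Ya) = dist Ya Tc := by
        rw [dist_eq_norm, dist_eq_norm]; congr 1; abel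
      rw [htx, this]
      exact hYc
    · -- `x ∈ Sh c`
      refine (hlk _ _ hcx).2 ?_
      have : dist Tc (Tb + Tc - Ya) = dist Ya Tb := by
        rw [dist_eq_norm, dist_eq_norm]; congr 1; abel
      rw [htx, this]
      exact hYb
    · -- `x ∉ Sh a`
      exact fun h => (not_le.2 hbig') ((hlk _ _ hax).1 h)
  · -- fold-back case: impossible, the apex would be too close to `u`
    exfalso
    have h1 : ‖nd u • A (Tb + Tc - Ya)‖ ≤ nd u * (61 / 100) := by
      rw [norm_smul, Real.norm_of_nonneg hd.le, A.norm_map]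
      exact mul_le_mul_of_nonneg_left hfold hd.le
    have h2 : ‖b + c - a - u‖ ≤
        dist (b + c - a - u) (nd u • A (Tb + Tc - Ya)) + ‖nd u • A (Tb + Tc - Ya)‖ := by
      have := dist_triangle (b + c - a - u) (nd u • A (Tb + Tc - Ya)) 0
      rwa [dist_zero_right, dist_zero_right] at this
    linarith

/-! ### Octahedron completion, core form -/

/-- **Octahedron completion, core form.** For a set `S` with nearest-neighbour distance `nd` and
first shells `Sh` (membership rule `hSh`), the shell-symmetry conclusions `hSM`, the link lemma
`hLK`, and at every site a `1/20`-matching of its shell with a pattern of unit vectors, pairwise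
`≥ 1`, with spectrum gap `(26/25, 7/5)` and the two dichotomy clauses (`hgoodP`): every square
face `t₁ t₂ t₃ t₄` of the link of `y ∈ S` is capped by a site `x ∈ S`, `x ≠ y`, `x ∉ Sh y`, lying
in the shells of all four `tᵢ`. -/
theorem dr5ca_core {E : Type*} [NormedAddCommGroup E] [InnerProductSpace ℝ E] {S : Set E}
    {nd : E → ℝ} {Sh : E → Set E}
    (hSh : ∀ y z, z ∈ Sh y ↔ z ∈ S ∧ z ≠ y ∧ dist z y < 13 / 10 * nd y)
    (hSM : ∀ y ∈ S, ∀ z ∈ S, z ≠ y → dist z y < 13 / 10 * nd y →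
      nd y ≤ dist z y ∧ dist z y ≤ 21 / 20 * nd y ∧ dist y z < 13 / 10 * nd z ∧
        dist y z ≤ 21 / 20 * nd z)
    (hLK : ∀ P : Set E, (∀ p ∈ P, ‖p‖ = 1) → (∀ p ∈ P, ∀ q ∈ P, p ≠ q → 1 ≤ dist p q) →
      (∀ p ∈ P, ∀ q ∈ P, dist p q ≤ 26 / 25 ∨ 7 / 5 ≤ dist p q) → ∀ y ∈ S, ∀ A : E →ₗᵢ[ℝ] E,
      ∀ e : ↥(Sh y) ≃ ↥P, (∀ t : ↥(Sh y), dist ((nd y)⁻¹ • (t.1 - y)) (A (e t).1) ≤ 1 / 20) →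
      ∀ t t' : ↥(Sh y), t ≠ t' → (t'.1 ∈ Sh t.1 ↔ dist (e t).1 (e t').1 ≤ 26 / 25))
    (hgoodP : ∀ y ∈ S, ∃ P : Set E, (∀ p ∈ P, ‖p‖ = 1) ∧
      (∀ p ∈ P, ∀ q ∈ P, p ≠ q → 1 ≤ dist p q) ∧
      (∀ p ∈ P, ∀ q ∈ P, dist p q ≤ 26 / 25 ∨ 7 / 5 ≤ dist p q) ∧
      (∀ Y ∈ P, ∀ T ∈ P, ∀ T' ∈ P, dist Y T ≤ 26 / 25 → dist Y T' ≤ 26 / 25 → T ≠ T' →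
        26 / 25 < dist T T' → (T + T' - Y ∈ P ∧ dist T T' ≤ 3 / 2) ∨ ‖T + T' - Y‖ ≤ 61 / 100) ∧
      (∀ T₁ ∈ P, ∀ T₂ ∈ P, ∀ T₃ ∈ P, ∀ T₄ ∈ P, dist T₁ T₂ ≤ 26 / 25 → dist T₂ T₃ ≤ 26 / 25 →
        dist T₃ T₄ ≤ 26 / 25 → dist T₄ T₁ ≤ 26 / 25 → 26 / 25 < dist T₁ T₃ →
        26 / 25 < dist T₂ T₄ → T₁ + T₃ = T₂ + T₄) ∧
      ∃ A : E →ₗᵢ[ℝ] E, ∃ e : ↥(Sh y) ≃ ↥P,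
        ∀ t : ↥(Sh y), dist ((nd y)⁻¹ • (t.1 - y)) (A (e t).1) ≤ 1 / 20)
    {y : E} (hy : y ∈ S) {t₁ t₂ t₃ t₄ : E} (h1 : t₁ ∈ Sh y) (h2 : t₂ ∈ Sh y) (h3 : t₃ ∈ Sh y)
    (h4 : t₄ ∈ Sh y) (h12 : t₂ ∈ Sh t₁) (h23 : t₃ ∈ Sh t₂) (h34 : t₄ ∈ Sh t₃) (h41 : t₁ ∈ Sh t₄)
    (h13 : t₃ ∉ Sh t₁) (h24 : t₄ ∉ Sh t₂) (hne13 : t₁ ≠ t₃) (hne24 : t₂ ≠ t₄) :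
    ∃ x ∈ S, x ≠ y ∧ x ∉ Sh y ∧ x ∈ Sh t₁ ∧ x ∈ Sh t₂ ∧ x ∈ Sh t₃ ∧ x ∈ Sh t₄ := by
  -- generalities: `nd` is positive at a site with a shell point, the shell relation is symmetric,
  -- and the scales of shell-mates compare: `20/21 · d_u ≤ d_z ≤ 21/20 · d_u`
  have hpos : ∀ u z, z ∈ Sh u → 0 < nd u := fun u z hz => by
    have := ((hSh u z).1 hz).2.2
    linarith [dist_nonneg (x := z) (y := u)]
  have hsymm : ∀ u z, u ∈ S → z ∈ Sh u → u ∈ Sh z := fun u z hu hz => by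
    obtain ⟨hzS, hzu, hlt⟩ := (hSh u z).1 hz
    exact (hSh z u).2 ⟨hu, fun h => hzu h.symm, (hSM u hu z hzS hzu hlt).2.2.1⟩
  have hscale : ∀ u z, u ∈ S → z ∈ Sh u → nd z ≤ 21 / 20 * nd u ∧ 20 / 21 * nd u ≤ nd z :=
      fun u z hu hz => by
    obtain ⟨hzS, hzu, hlt⟩ := (hSh u z).1 hz
    obtain ⟨ha, hb, hc, hd'⟩ := hSM u hu z hzS hzu hlt
    obtain ⟨ha', -, -, -⟩ := hSM z hzS u hu (fun h => hzu h.symm) hc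
    rw [dist_comm] at ha' hd'
    constructor <;> linarith
  have hd := hpos y t₁ h1
  obtain ⟨ht₁S, -, -⟩ := (hSh y t₁).1 h1
  obtain ⟨ht₂S, -, -⟩ := (hSh y t₂).1 h2
  obtain ⟨ht₄S, -, -⟩ := (hSh y t₄).1 h4
  -- Step 1: the parallelogram at `y`
  obtain ⟨P, hP1, hP2, hP3, -, hDii, A, e, htol⟩ := hgoodP y hy
  obtain ⟨hfar1, hfar2, hxx⟩ := dr5ca_para hSh hP1 hDii hd A e htol
    (hLK P hP1 hP2 hP3 y hy A e htol) h1 h2 h3 h4 h12 h23 h34 h41 h13 h24 hne13 hne24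
  -- Steps 2–3: the corner `(y; t₂, t₄)` read in the shell of `t₁` gives the cap `x`
  obtain ⟨P₁, hP1₁, hP2₁, hP3₁, hDi₁, -, A₁, e₁, htol₁⟩ := hgoodP t₁ ht₁S
  have hd₁ := hpos t₁ t₂ h12
  obtain ⟨hs₁, -⟩ := hscale y t₁ hy h1
  have hfar1' : 76 / 100 * nd t₁ < ‖t₂ + t₄ - y - t₁‖ := by linarith
  obtain ⟨x, hx1, hxd, hx2, hx4, hxy, hxney⟩ := dr5ca_corner hSh hP2₁ hDi₁ hd₁ A₁ e₁ htol₁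
    (hLK P₁ hP1₁ hP2₁ hP3₁ t₁ ht₁S A₁ e₁ htol₁) (hsymm y t₁ hy h1) h12 (hsymm t₄ t₁ ht₄S h41)
    h2 h4 h24 hne24 hfar1'
  -- Step 4: the corner `(y; t₁, t₃)` read in the shell of `t₂` gives a site `z ∈ Sh t₃` near `x`
  obtain ⟨P₂, hP1₂, hP2₂, hP3₂, hDi₂, -, A₂, e₂, htol₂⟩ := hgoodP t₂ ht₂S
  have hd₂ := hpos t₂ t₃ h23
  obtain ⟨hs₂, hs₂'⟩ := hscale y t₂ hy h2
  have hfar2' : 76 / 100 * nd t₂ < ‖t₁ + t₃ - y - t₂‖ := by linarith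
  obtain ⟨z, hz2, hzd, -, hz3, -, -⟩ := dr5ca_corner hSh hP2₂ hDi₂ hd₂ A₂ e₂ htol₂
    (hLK P₂ hP1₂ hP2₂ hP3₂ t₂ ht₂S A₂ e₂ htol₂) (hsymm y t₂ hy h2) (hsymm t₁ t₂ ht₁S h12) h23
    h1 h3 h13 hne13 hfar2'
  -- `z = x`: two distinct shell points of `t₂` are `≥ 9/10 · d_{t₂} ≥ 6/7 · d_y` apart, while
  -- `dist x z ≤ (21/100 + 1/5 + 21/100) · d_y`
  have hzx : z = x := by
    by_contra hzx
    have hsep := dr5ca_shell_sep hP2₂ hd₂ A₂ e₂ htol₂ hx2 hz2 (Ne.symm hzx)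
    have htri := dist_triangle4 x (t₂ + t₄ - y) (t₁ + t₃ - y) z
    rw [dist_comm] at hzd
    linarith
  obtain ⟨hxS, -, -⟩ := (hSh t₁ x).1 hx1
  exact ⟨x, hxS, hxney, hxy, hx1, hx2, hzx ▸ hz3, hx4⟩

end Summit.AtomisticToContinuum.Crystallization.Theorems

end
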